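import Mathlib.CategoryTheory.Adjunction.CompositionIso
import Literature.AlgebraicGeometry.Motives.EtalePullbackComp
import Literature.AlgebraicGeometry.Motives.EtaleInverseImage
import HarnessLib

/-!
# Inverse images of étale sheaves with arbitrary coefficients, II: `(g f)^* ≅ f^* g^*`,
# `(𝟙)^* ≅ 𝟭` and their coherence with `π^* M ≅ M`

`EtalePullbackComp.lean` proved, for `Ab`-valued sheaves, the composition and identity
isomorphisms of the inverse image functors `etalePullback` (Milne II Rem. 3.1 (f)) and their
coherence with the constant-sheaf isomorphisms `π^* M_Y ≅ M_X` (II Rem. 3.1 (d)), and deduced the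
functoriality `(g f)^* = f^* ∘ g^*`, `(𝟙)^* = id` of the pull-back on `Hⁿ(–_et, M)` by the uniqueness
of `δ`-morphisms. This file is the verbatim generalisation of its *sheaf-level* part to the
`A`-valued inverse images `etaleInverseImage f A` of `EtaleInverseImage.lean` (`A` any
Grothendieck abelian concrete coefficient category, e.g. `ModuleCat R`):

* `etalePushforwardCompIso`, `etaleInverseImageComp f A g : g^* ⋙ f^* ≅ (g f)^*` (conjugate to
  `(g f)_* = g_* f_*`, Mathlib `Adjunction.leftAdjointCompIso`) and its unit relation;
  `etalePushforwardIdIso`, `etaleInverseImageId X A : (𝟙)^* ≅ 𝟭` and its unit relation;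
* `constantSection_comp_unit_comp_inverseImageConstantSheafIso`: what `π^* M_Y ≅ M_X` does to
  constant sections;
* the coherences `etaleInverseImageComp_inv_app_comp_constantSheafIso`
  (`(gf)^* M ≅ f^* g^* M ≅ f^* M ≅ M` is `(gf)^* M ≅ M`) and
  `etaleInverseImageId_hom_app_constantSheaf` (`(𝟙)^* M_X ≅ M_X` is the constant-sheaf iso).

The cohomological consequences for the `R`-linear theory (`(g f)^* = f^* ∘ g^*` on
`Hⁿ(–_ét, R)` with its cup product) follow in one line each from these coherences and the general
`Ext.mapExactFunctor_functorComp` / `_functorIso` (`ExtMapExactFunctor.lean`); they are left to the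
file assembling the functor `X ↦ H•(X_ét, ℤ/ℓᵐ)`.

## References

* J. S. Milne, *Étale cohomology* (reissue 2025; held copy): II §3 p. 75, II Rem. 3.1 (d), (f)
  pp. 76–77. [Milne2025]
* Mathlib: `Adjunction.leftAdjointCompIso`, `Adjunction.leftAdjointIdIso`, `unit_conjugateEquiv`,
  `Functor.sheafPushforwardContinuousComp'` / `Id'`.

## Design notes

* Generated from `EtalePullbackComp.lean` by the substitution `Ab ↦ A`,
  `etalePullback ↦ etaleInverseImage – A` (the proofs only use adjunction units and the hom-ext
  principle for constant sheaves `constantSheaf_hom_ext`, all coefficient-agnostic); the scheme-level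
  isomorphisms `etaleBaseChangeComp`, `etaleBaseChangeId` and the general constant-section API are
  imported from there, not restated.
-/

universe u' u

open CategoryTheory CategoryTheory.Limits AlgebraicGeometry Opposite

namespace Literature.AlgebraicGeometry.Motives

variable {X Y : Scheme.{u}} (f : X ⟶ Y)

variable (A : Type u') [Category.{u} A] {FA : A → A → Type*} {CA : A → Type u}
  [∀ P Q, FunLike (FA P Q) (CA P) (CA Q)] [ConcreteCategory.{u} A FA]
  [PreservesLimits (forget A)] [HasColimits A] [HasLimits A]
  [(forget A).ReflectsIsomorphisms] [PreservesFilteredColimitsOfSize.{u, u} (forget A)]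
  [Abelian A] [IsGrothendieckAbelian.{u} A]

/-! ### Composition: `(g ∘ f)^* ≅ f^* ∘ g^*` for `A`-valued sheaves -/

section Comp

variable {Z : Scheme.{u}} (g : Y ⟶ Z)

/-- **`(g ∘ f)_* = g_* ∘ f_*`** (Milne II Rem. 3.1 (f): "clearly `(π'π)_* = π'_* π_*`"), the
isomorphism induced by `etaleBaseChangeComp`. [cite: Milne2025, II Remark 3.1 (f)] -/
noncomputable def etalePushforwardCompIso :
    etalePushforward f A ⋙ etalePushforward g A ≅ etalePushforward (f ≫ g) A :=
  Functor.sheafPushforwardContinuousComp' (etaleBaseChangeComp f g).symm A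
    Z.smallEtaleTopology Y.smallEtaleTopology X.smallEtaleTopology

omit [HasColimits A] [HasLimits A] [Abelian A] [IsGrothendieckAbelian.{u} A] in
/-- Components of `etalePushforwardCompIso`: `(g_* f_* G)(W) = G((W ×_Z Y) ×_Y X) → G(W ×_Z X) =
((g f)_* G)(W)` is restriction along `W ×_Z X ≅ (W ×_Z Y) ×_Y X`. [folklore] -/
theorem etalePushforwardCompIso_hom_app_hom_app (G : Sheaf X.smallEtaleTopology A)
    (W : Z.Etale) :
    ((etalePushforwardCompIso f A g).hom.app G).hom.app (op W) =
      G.obj.map ((etaleBaseChangeComp f g).hom.app W).op := by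
  simp [etalePushforwardCompIso, Functor.sheafPushforwardContinuousComp',
    Functor.sheafPushforwardContinuousComp, Functor.sheafPushforwardContinuousIso]
  exact Category.id_comp _

/-- **`π^* π'^* = (π' π)^*`** (Milne II Rem. 3.1 (f): "`π^* π'^*` is adjoint to `π'_* π_*`, which
implies that `π^* π'^* = (π'π)^*`"): the isomorphism of left adjoints conjugate to
`etalePushforwardCompIso` (Mathlib `Adjunction.leftAdjointCompIso`).
[cite: Milne2025, II Remark 3.1 (f)] -/
noncomputable def etaleInverseImageComp :
    etaleInverseImage g A ⋙ etaleInverseImage f A ≅ etaleInverseImage (f ≫ g) A :=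
  Adjunction.leftAdjointCompIso (etaleInverseImageAdjunction g A) (etaleInverseImageAdjunction f A)
    (etaleInverseImageAdjunction (f ≫ g) A) (etalePushforwardCompIso f A g)

/-- `etaleInverseImageComp` is conjugate to `etalePushforwardCompIso`. [folklore] -/
theorem conjugateEquiv_etaleInverseImageComp_inv :
    conjugateEquiv ((etaleInverseImageAdjunction g A).comp (etaleInverseImageAdjunction f A))
        (etaleInverseImageAdjunction (f ≫ g) A) (etaleInverseImageComp f A g).inv =
      (etalePushforwardCompIso f A g).hom :=
  Adjunction.conjugateEquiv_leftAdjointCompIso_inv _ _ _ _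

set_option backward.isDefEq.respectTransparency false in
/-- The unit relation defining `etaleInverseImageComp`: for a sheaf `P` on `Z_et` and `W ∈ Z_et`,
`η_{gf}(W) ≫ (c⁻¹_P)(W ×_Z X) = η_g(W) ≫ η_f(W ×_Z Y) ≫ (restriction along
W ×_Z X ≅ (W ×_Z Y) ×_Y X)`. [folklore] -/
theorem unit_app_comp_etaleInverseImageComp_inv_app (P : Sheaf Z.smallEtaleTopology A)
    (W : Z.Etale) :
    ((etaleInverseImageAdjunction (f ≫ g) A).unit.app P).hom.app (op W) ≫
        ((etaleInverseImageComp f A g).inv.app P).hom.app (op ((etaleBaseChange (f ≫ g)).obj W)) =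
      ((etaleInverseImageAdjunction g A).unit.app P).hom.app (op W) ≫
        ((etaleInverseImageAdjunction f A).unit.app ((etaleInverseImage g A).obj P)).hom.app
          (op ((etaleBaseChange g).obj W)) ≫
        ((etaleInverseImage f A).obj ((etaleInverseImage g A).obj P)).obj.map
          ((etaleBaseChangeComp f g).hom.app W).op := by
  have h := unit_conjugateEquiv ((etaleInverseImageAdjunction g A).comp
    (etaleInverseImageAdjunction f A)) (etaleInverseImageAdjunction (f ≫ g) A) (etaleInverseImageComp f A g).inv P
  rw [conjugateEquiv_etaleInverseImageComp_inv, Adjunction.comp_unit_app] at h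
  have h' := Sheaf.congr_hom_app h (op W)
  have key := etalePushforwardCompIso_hom_app_hom_app f A g
    ((etaleInverseImage f A).obj ((etaleInverseImage g A).obj P)) W
  have e3 : (((etaleInverseImageAdjunction g A).unit.app P).hom.app (op W) ≫
      ((etaleInverseImageAdjunction f A).unit.app ((etaleInverseImage g A).obj P)).hom.app
        (op ((etaleBaseChange g).obj W))) ≫
      ((etalePushforwardCompIso f A g).hom.app
        ((etaleInverseImage f A).obj ((etaleInverseImage g A).obj P))).hom.app (op W) =
      ((etaleInverseImageAdjunction g A).unit.app P).hom.app (op W) ≫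
        ((etaleInverseImageAdjunction f A).unit.app ((etaleInverseImage g A).obj P)).hom.app
          (op ((etaleBaseChange g).obj W)) ≫
        ((etaleInverseImage f A).obj ((etaleInverseImage g A).obj P)).obj.map
          ((etaleBaseChangeComp f g).hom.app W).op := by
    rw [key, Category.assoc]
  exact h'.symm.trans e3

end Comp

/-! ### What `π^* M_Y ≅ M_X` does to constant sections (`A`-valued) -/

section ConstantSections

variable (M : A)

set_option backward.isDefEq.respectTransparency false in
/-- The defining property of `π^* M_Y ≅ M_X` on constant sections over the final object `Y`:
`(constant section) ≫ η(Y) ≫ ι(Y ×_Y X) = (constant section)`. [folklore] -/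
theorem constantSection_comp_unit_comp_inverseImageConstantSheafIso_terminal :
    constantSection Y.smallEtaleTopology M (Scheme.Etale.mk (𝟙 Y)) ≫
      ((etaleInverseImageAdjunction f A).unit.app ((constantSheaf Y.smallEtaleTopology A).obj M)).hom.app (op (Scheme.Etale.mk (𝟙 Y))) ≫
      ((etaleInverseImageConstantSheafIso f A M).hom).hom.app (op ((etaleBaseChange f).obj (Scheme.Etale.mk (𝟙 Y)))) =
    constantSection X.smallEtaleTopology M ((etaleBaseChange f).obj (Scheme.Etale.mk (𝟙 Y))) := by
  have e1 : (constantSheafCompEtaleInverseImageAdj f A).homEquiv _ _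
      ((constantSheafCompEtaleInverseImageIso f A).hom.app M) =
      (constantSheafAdjEtaleBaseChange' f A).unit.app M :=
    Adjunction.homEquiv_leftAdjointUniq_hom_app _ _ M
  have e2 : (constantSheafCompEtaleInverseImageAdj f A).homEquiv _ _
      ((constantSheafCompEtaleInverseImageIso f A).hom.app M) =
      (constantSheafAdj _ A (isTerminalEtaleMkId Y)).homEquiv _ _
        ((etaleInverseImageAdjunction f A).homEquiv _ _
          ((constantSheafCompEtaleInverseImageIso f A).hom.app M)) := by
    rw [constantSheafCompEtaleInverseImageAdj, Adjunction.comp_homEquiv]; rfl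
  have e3 : (constantSheafAdj _ A (isTerminalEtaleMkId Y)).homEquiv _ _
        ((etaleInverseImageAdjunction f A).homEquiv _ _
          ((constantSheafCompEtaleInverseImageIso f A).hom.app M)) =
      constantSection Y.smallEtaleTopology M (Scheme.Etale.mk (𝟙 Y)) ≫
      ((etaleInverseImageAdjunction f A).unit.app ((constantSheaf Y.smallEtaleTopology A).obj M)).hom.app (op (Scheme.Etale.mk (𝟙 Y))) ≫
      ((etaleInverseImageConstantSheafIso f A M).hom).hom.app (op ((etaleBaseChange f).obj (Scheme.Etale.mk (𝟙 Y)))) := by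
    rw [Adjunction.homEquiv_unit, Adjunction.homEquiv_unit, constantSheafAdj_unit_app]
    rfl
  have e4 : (constantSheafAdjEtaleBaseChange' f A).unit.app M =
      constantSection X.smallEtaleTopology M ((etaleBaseChange f).obj (Scheme.Etale.mk (𝟙 Y))) := by
    change (constantSheafAdj _ A (isTerminalEtaleBaseChangeObjMkId f)).unit.app M ≫ 𝟙 _ = _
    rw [Category.comp_id, constantSheafAdj_unit_app]
  exact e3.symm.trans (e2.symm.trans (e1.trans e4))

set_option backward.isDefEq.respectTransparency false in
/-- **What `π^* M_Y ≅ M_X` does to constant sections**: for every `V ∈ Y_et`, the composite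
`M → M_Y(V) → (π_* π^* M_Y)(V) = (π^* M_Y)(V ×_Y X) → M_X(V ×_Y X)` of constant section, unit
of `π^* ⊣ π_*` and `π^* M_Y ≅ M_X` is the constant section (at the final object this is the
defining property of the isomorphism; in general, restrict along `V → Y`). [folklore] -/
@[reassoc]
theorem constantSection_comp_unit_comp_inverseImageConstantSheafIso (V : Y.Etale) :
    constantSection Y.smallEtaleTopology M (V) ≫ ((etaleInverseImageAdjunction f A).unit.app ((constantSheaf Y.smallEtaleTopology A).obj M)).hom.app (op (V)) ≫ ((etaleInverseImageConstantSheafIso f A M).hom).hom.app (op ((etaleBaseChange f).obj V)) =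
    constantSection X.smallEtaleTopology M ((etaleBaseChange f).obj V) := by
  let T : Y.Etale := Scheme.Etale.mk (𝟙 Y)
  let t : V ⟶ T := (isTerminalEtaleMkId Y).from V
  have hκ := constantSection_comp_map Y.smallEtaleTopology M t
  have hη := ((etaleInverseImageAdjunction f A).unit.app ((constantSheaf Y.smallEtaleTopology A).obj M)).hom.naturality t.op
  have hι := ((etaleInverseImageConstantSheafIso f A M).hom).hom.naturality
    ((etaleBaseChange f).map t).op
  have hκ' := constantSection_comp_map X.smallEtaleTopology M ((etaleBaseChange f).map t)
  have h0 := constantSection_comp_unit_comp_inverseImageConstantSheafIso_terminal f A M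
  calc constantSection Y.smallEtaleTopology M (V) ≫ ((etaleInverseImageAdjunction f A).unit.app ((constantSheaf Y.smallEtaleTopology A).obj M)).hom.app (op (V)) ≫ ((etaleInverseImageConstantSheafIso f A M).hom).hom.app (op ((etaleBaseChange f).obj V))
      = (constantSection Y.smallEtaleTopology M (T) ≫ ((constantSheaf Y.smallEtaleTopology A).obj M).obj.map t.op) ≫ ((etaleInverseImageAdjunction f A).unit.app ((constantSheaf Y.smallEtaleTopology A).obj M)).hom.app (op (V)) ≫
          ((etaleInverseImageConstantSheafIso f A M).hom).hom.app (op ((etaleBaseChange f).obj V)) := by rw [hκ]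
    _ = constantSection Y.smallEtaleTopology M (T) ≫ (((constantSheaf Y.smallEtaleTopology A).obj M).obj.map t.op ≫ ((etaleInverseImageAdjunction f A).unit.app ((constantSheaf Y.smallEtaleTopology A).obj M)).hom.app (op (V))) ≫
          ((etaleInverseImageConstantSheafIso f A M).hom).hom.app (op ((etaleBaseChange f).obj V)) := by simp only [Category.assoc]
    _ = constantSection Y.smallEtaleTopology M (T) ≫ (((etaleInverseImageAdjunction f A).unit.app ((constantSheaf Y.smallEtaleTopology A).obj M)).hom.app (op (T)) ≫ ((etaleInverseImage f A).obj ((constantSheaf Y.smallEtaleTopology A).obj M)).obj.map ((etaleBaseChange f).map t).op) ≫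
          ((etaleInverseImageConstantSheafIso f A M).hom).hom.app (op ((etaleBaseChange f).obj V)) :=
        congrArg (fun φ => constantSection Y.smallEtaleTopology M (T) ≫ φ ≫ ((etaleInverseImageConstantSheafIso f A M).hom).hom.app (op ((etaleBaseChange f).obj V))) hη
    _ = constantSection Y.smallEtaleTopology M (T) ≫ ((etaleInverseImageAdjunction f A).unit.app ((constantSheaf Y.smallEtaleTopology A).obj M)).hom.app (op (T)) ≫ (((etaleInverseImage f A).obj ((constantSheaf Y.smallEtaleTopology A).obj M)).obj.map ((etaleBaseChange f).map t).op ≫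
          ((etaleInverseImageConstantSheafIso f A M).hom).hom.app (op ((etaleBaseChange f).obj V))) := by simp only [Category.assoc]
    _ = constantSection Y.smallEtaleTopology M (T) ≫ ((etaleInverseImageAdjunction f A).unit.app ((constantSheaf Y.smallEtaleTopology A).obj M)).hom.app (op (T)) ≫ (((etaleInverseImageConstantSheafIso f A M).hom).hom.app (op ((etaleBaseChange f).obj T)) ≫
          ((constantSheaf X.smallEtaleTopology A).obj M).obj.map ((etaleBaseChange f).map t).op) := by rw [hι]
    _ = (constantSection Y.smallEtaleTopology M (T) ≫ ((etaleInverseImageAdjunction f A).unit.app ((constantSheaf Y.smallEtaleTopology A).obj M)).hom.app (op (T)) ≫ ((etaleInverseImageConstantSheafIso f A M).hom).hom.app (op ((etaleBaseChange f).obj T))) ≫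
          ((constantSheaf X.smallEtaleTopology A).obj M).obj.map ((etaleBaseChange f).map t).op := by simp only [Category.assoc]
    _ = constantSection X.smallEtaleTopology M ((etaleBaseChange f).obj T) ≫ ((constantSheaf X.smallEtaleTopology A).obj M).obj.map ((etaleBaseChange f).map t).op := by
        rw [h0]
    _ = _ := hκ'

end ConstantSections

/-! ### Coherence of `(g f)^* ≅ f^* g^*` with the constant-sheaf isomorphisms -/

section CompConstant

variable {Z : Scheme.{u}} (g : Y ⟶ Z) (M : A)

set_option backward.isDefEq.respectTransparency false in
/-- On constant sections over `Z ×_Z X`, the composite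
`M_X ≅ (gf)^* M_Z ≅ f^* g^* M_Z ≅ f^* M_Y ≅ M_X` is the identity. [folklore] -/
theorem constantSection_comp_inverseImageConstantSheafIso_coherence :
    constantSection X.smallEtaleTopology M ((etaleBaseChange (f ≫ g)).obj (Scheme.Etale.mk (𝟙 Z))) ≫ ((etaleInverseImageConstantSheafIso (f ≫ g) A M).inv).hom.app (op ((etaleBaseChange (f ≫ g)).obj (Scheme.Etale.mk (𝟙 Z)))) ≫ ((etaleInverseImageComp f A g).inv.app ((constantSheaf Z.smallEtaleTopology A).obj M)).hom.app (op ((etaleBaseChange (f ≫ g)).obj (Scheme.Etale.mk (𝟙 Z)))) ≫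
      ((etaleInverseImage f A).map (etaleInverseImageConstantSheafIso g A M).hom).hom.app (op ((etaleBaseChange (f ≫ g)).obj (Scheme.Etale.mk (𝟙 Z)))) ≫ ((etaleInverseImageConstantSheafIso f A M).hom).hom.app (op ((etaleBaseChange (f ≫ g)).obj (Scheme.Etale.mk (𝟙 Z)))) =
    constantSection X.smallEtaleTopology M ((etaleBaseChange (f ≫ g)).obj (Scheme.Etale.mk (𝟙 Z))) := by
  have L1fg := constantSection_comp_unit_comp_inverseImageConstantSheafIso (f ≫ g) A M (Scheme.Etale.mk (𝟙 Z))
  have hinv : ((etaleInverseImageConstantSheafIso (f ≫ g) A M).hom).hom.app (op ((etaleBaseChange (f ≫ g)).obj (Scheme.Etale.mk (𝟙 Z)))) ≫ ((etaleInverseImageConstantSheafIso (f ≫ g) A M).inv).hom.app (op ((etaleBaseChange (f ≫ g)).obj (Scheme.Etale.mk (𝟙 Z)))) = 𝟙 _ :=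
    Sheaf.congr_hom_app (etaleInverseImageConstantSheafIso (f ≫ g) A M).hom_inv_id (op ((etaleBaseChange (f ≫ g)).obj (Scheme.Etale.mk (𝟙 Z))))
  have hinv' : ((etaleInverseImageAdjunction (f ≫ g) A).unit.app ((constantSheaf Z.smallEtaleTopology A).obj M)).hom.app (op (Scheme.Etale.mk (𝟙 Z))) ≫ ((etaleInverseImageConstantSheafIso (f ≫ g) A M).hom).hom.app (op ((etaleBaseChange (f ≫ g)).obj (Scheme.Etale.mk (𝟙 Z)))) ≫ ((etaleInverseImageConstantSheafIso (f ≫ g) A M).inv).hom.app (op ((etaleBaseChange (f ≫ g)).obj (Scheme.Etale.mk (𝟙 Z)))) = ((etaleInverseImageAdjunction (f ≫ g) A).unit.app ((constantSheaf Z.smallEtaleTopology A).obj M)).hom.app (op (Scheme.Etale.mk (𝟙 Z))) := by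
    rw [hinv]; exact Category.comp_id _
  have s1 : constantSection X.smallEtaleTopology M ((etaleBaseChange (f ≫ g)).obj (Scheme.Etale.mk (𝟙 Z))) ≫ ((etaleInverseImageConstantSheafIso (f ≫ g) A M).inv).hom.app (op ((etaleBaseChange (f ≫ g)).obj (Scheme.Etale.mk (𝟙 Z)))) = constantSection Z.smallEtaleTopology M (Scheme.Etale.mk (𝟙 Z)) ≫ ((etaleInverseImageAdjunction (f ≫ g) A).unit.app ((constantSheaf Z.smallEtaleTopology A).obj M)).hom.app (op (Scheme.Etale.mk (𝟙 Z))) := by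
    rw [← L1fg]; simp only [Category.assoc]; rw [hinv']
  have s2 : ((etaleInverseImageAdjunction (f ≫ g) A).unit.app ((constantSheaf Z.smallEtaleTopology A).obj M)).hom.app (op (Scheme.Etale.mk (𝟙 Z))) ≫ ((etaleInverseImageComp f A g).inv.app ((constantSheaf Z.smallEtaleTopology A).obj M)).hom.app (op ((etaleBaseChange (f ≫ g)).obj (Scheme.Etale.mk (𝟙 Z)))) = ((etaleInverseImageAdjunction g A).unit.app ((constantSheaf Z.smallEtaleTopology A).obj M)).hom.app (op (Scheme.Etale.mk (𝟙 Z))) ≫ ((etaleInverseImageAdjunction f A).unit.app ((etaleInverseImage g A).obj ((constantSheaf Z.smallEtaleTopology A).obj M))).hom.app (op ((etaleBaseChange g).obj (Scheme.Etale.mk (𝟙 Z)))) ≫ ((etaleInverseImage f A).obj ((etaleInverseImage g A).obj ((constantSheaf Z.smallEtaleTopology A).obj M))).obj.map ((etaleBaseChangeComp f g).hom.app (Scheme.Etale.mk (𝟙 Z))).op :=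
    unit_app_comp_etaleInverseImageComp_inv_app f A g ((constantSheaf Z.smallEtaleTopology A).obj M) (Scheme.Etale.mk (𝟙 Z))
  have s3 : ((etaleInverseImage f A).obj ((etaleInverseImage g A).obj ((constantSheaf Z.smallEtaleTopology A).obj M))).obj.map ((etaleBaseChangeComp f g).hom.app (Scheme.Etale.mk (𝟙 Z))).op ≫ ((etaleInverseImage f A).map (etaleInverseImageConstantSheafIso g A M).hom).hom.app (op ((etaleBaseChange (f ≫ g)).obj (Scheme.Etale.mk (𝟙 Z)))) = ((etaleInverseImage f A).map (etaleInverseImageConstantSheafIso g A M).hom).hom.app (op ((etaleBaseChange f).obj ((etaleBaseChange g).obj (Scheme.Etale.mk (𝟙 Z))))) ≫ ((etaleInverseImage f A).obj ((constantSheaf Y.smallEtaleTopology A).obj M)).obj.map ((etaleBaseChangeComp f g).hom.app (Scheme.Etale.mk (𝟙 Z))).op :=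
    ((etaleInverseImage f A).map (etaleInverseImageConstantSheafIso g A M).hom).hom.naturality ((etaleBaseChangeComp f g).hom.app (Scheme.Etale.mk (𝟙 Z))).op
  have s4 : ((etaleInverseImageAdjunction f A).unit.app ((etaleInverseImage g A).obj ((constantSheaf Z.smallEtaleTopology A).obj M))).hom.app (op ((etaleBaseChange g).obj (Scheme.Etale.mk (𝟙 Z)))) ≫ ((etaleInverseImage f A).map (etaleInverseImageConstantSheafIso g A M).hom).hom.app (op ((etaleBaseChange f).obj ((etaleBaseChange g).obj (Scheme.Etale.mk (𝟙 Z))))) = ((etaleInverseImageConstantSheafIso g A M).hom).hom.app (op ((etaleBaseChange g).obj (Scheme.Etale.mk (𝟙 Z)))) ≫ ((etaleInverseImageAdjunction f A).unit.app ((constantSheaf Y.smallEtaleTopology A).obj M)).hom.app (op ((etaleBaseChange g).obj (Scheme.Etale.mk (𝟙 Z)))) :=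
    (Sheaf.congr_hom_app ((etaleInverseImageAdjunction f A).unit.naturality
      (etaleInverseImageConstantSheafIso g A M).hom) (op ((etaleBaseChange g).obj (Scheme.Etale.mk (𝟙 Z))))).symm
  have s5 : constantSection Z.smallEtaleTopology M (Scheme.Etale.mk (𝟙 Z)) ≫ ((etaleInverseImageAdjunction g A).unit.app ((constantSheaf Z.smallEtaleTopology A).obj M)).hom.app (op (Scheme.Etale.mk (𝟙 Z))) ≫ ((etaleInverseImageConstantSheafIso g A M).hom).hom.app (op ((etaleBaseChange g).obj (Scheme.Etale.mk (𝟙 Z)))) = constantSection Y.smallEtaleTopology M ((etaleBaseChange g).obj (Scheme.Etale.mk (𝟙 Z))) :=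
    constantSection_comp_unit_comp_inverseImageConstantSheafIso g A M (Scheme.Etale.mk (𝟙 Z))
  have s6 : ((etaleInverseImage f A).obj ((constantSheaf Y.smallEtaleTopology A).obj M)).obj.map ((etaleBaseChangeComp f g).hom.app (Scheme.Etale.mk (𝟙 Z))).op ≫ ((etaleInverseImageConstantSheafIso f A M).hom).hom.app (op ((etaleBaseChange (f ≫ g)).obj (Scheme.Etale.mk (𝟙 Z)))) = ((etaleInverseImageConstantSheafIso f A M).hom).hom.app (op ((etaleBaseChange f).obj ((etaleBaseChange g).obj (Scheme.Etale.mk (𝟙 Z))))) ≫ ((constantSheaf X.smallEtaleTopology A).obj M).obj.map ((etaleBaseChangeComp f g).hom.app (Scheme.Etale.mk (𝟙 Z))).op :=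
    ((etaleInverseImageConstantSheafIso f A M).hom).hom.naturality ((etaleBaseChangeComp f g).hom.app (Scheme.Etale.mk (𝟙 Z))).op
  have s7 : constantSection Y.smallEtaleTopology M ((etaleBaseChange g).obj (Scheme.Etale.mk (𝟙 Z))) ≫ ((etaleInverseImageAdjunction f A).unit.app ((constantSheaf Y.smallEtaleTopology A).obj M)).hom.app (op ((etaleBaseChange g).obj (Scheme.Etale.mk (𝟙 Z)))) ≫ ((etaleInverseImageConstantSheafIso f A M).hom).hom.app (op ((etaleBaseChange f).obj ((etaleBaseChange g).obj (Scheme.Etale.mk (𝟙 Z))))) = constantSection X.smallEtaleTopology M ((etaleBaseChange f).obj ((etaleBaseChange g).obj (Scheme.Etale.mk (𝟙 Z)))) :=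
    constantSection_comp_unit_comp_inverseImageConstantSheafIso f A M ((etaleBaseChange g).obj (Scheme.Etale.mk (𝟙 Z)))
  have s8 : constantSection X.smallEtaleTopology M ((etaleBaseChange f).obj ((etaleBaseChange g).obj (Scheme.Etale.mk (𝟙 Z)))) ≫ ((constantSheaf X.smallEtaleTopology A).obj M).obj.map ((etaleBaseChangeComp f g).hom.app (Scheme.Etale.mk (𝟙 Z))).op = constantSection X.smallEtaleTopology M ((etaleBaseChange (f ≫ g)).obj (Scheme.Etale.mk (𝟙 Z))) :=
    constantSection_comp_map X.smallEtaleTopology M ((etaleBaseChangeComp f g).hom.app (Scheme.Etale.mk (𝟙 Z)))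
  calc constantSection X.smallEtaleTopology M ((etaleBaseChange (f ≫ g)).obj (Scheme.Etale.mk (𝟙 Z))) ≫ ((etaleInverseImageConstantSheafIso (f ≫ g) A M).inv).hom.app (op ((etaleBaseChange (f ≫ g)).obj (Scheme.Etale.mk (𝟙 Z)))) ≫ ((etaleInverseImageComp f A g).inv.app ((constantSheaf Z.smallEtaleTopology A).obj M)).hom.app (op ((etaleBaseChange (f ≫ g)).obj (Scheme.Etale.mk (𝟙 Z)))) ≫ ((etaleInverseImage f A).map (etaleInverseImageConstantSheafIso g A M).hom).hom.app (op ((etaleBaseChange (f ≫ g)).obj (Scheme.Etale.mk (𝟙 Z)))) ≫ ((etaleInverseImageConstantSheafIso f A M).hom).hom.app (op ((etaleBaseChange (f ≫ g)).obj (Scheme.Etale.mk (𝟙 Z))))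
      = (constantSection X.smallEtaleTopology M ((etaleBaseChange (f ≫ g)).obj (Scheme.Etale.mk (𝟙 Z))) ≫ ((etaleInverseImageConstantSheafIso (f ≫ g) A M).inv).hom.app (op ((etaleBaseChange (f ≫ g)).obj (Scheme.Etale.mk (𝟙 Z))))) ≫ ((etaleInverseImageComp f A g).inv.app ((constantSheaf Z.smallEtaleTopology A).obj M)).hom.app (op ((etaleBaseChange (f ≫ g)).obj (Scheme.Etale.mk (𝟙 Z)))) ≫ ((etaleInverseImage f A).map (etaleInverseImageConstantSheafIso g A M).hom).hom.app (op ((etaleBaseChange (f ≫ g)).obj (Scheme.Etale.mk (𝟙 Z)))) ≫ ((etaleInverseImageConstantSheafIso f A M).hom).hom.app (op ((etaleBaseChange (f ≫ g)).obj (Scheme.Etale.mk (𝟙 Z)))) := by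
        simp only [Category.assoc]
    _ = (constantSection Z.smallEtaleTopology M (Scheme.Etale.mk (𝟙 Z)) ≫ ((etaleInverseImageAdjunction (f ≫ g) A).unit.app ((constantSheaf Z.smallEtaleTopology A).obj M)).hom.app (op (Scheme.Etale.mk (𝟙 Z)))) ≫ ((etaleInverseImageComp f A g).inv.app ((constantSheaf Z.smallEtaleTopology A).obj M)).hom.app (op ((etaleBaseChange (f ≫ g)).obj (Scheme.Etale.mk (𝟙 Z)))) ≫ ((etaleInverseImage f A).map (etaleInverseImageConstantSheafIso g A M).hom).hom.app (op ((etaleBaseChange (f ≫ g)).obj (Scheme.Etale.mk (𝟙 Z)))) ≫ ((etaleInverseImageConstantSheafIso f A M).hom).hom.app (op ((etaleBaseChange (f ≫ g)).obj (Scheme.Etale.mk (𝟙 Z)))) := by rw [s1]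
    _ = constantSection Z.smallEtaleTopology M (Scheme.Etale.mk (𝟙 Z)) ≫ (((etaleInverseImageAdjunction (f ≫ g) A).unit.app ((constantSheaf Z.smallEtaleTopology A).obj M)).hom.app (op (Scheme.Etale.mk (𝟙 Z))) ≫ ((etaleInverseImageComp f A g).inv.app ((constantSheaf Z.smallEtaleTopology A).obj M)).hom.app (op ((etaleBaseChange (f ≫ g)).obj (Scheme.Etale.mk (𝟙 Z))))) ≫ ((etaleInverseImage f A).map (etaleInverseImageConstantSheafIso g A M).hom).hom.app (op ((etaleBaseChange (f ≫ g)).obj (Scheme.Etale.mk (𝟙 Z)))) ≫ ((etaleInverseImageConstantSheafIso f A M).hom).hom.app (op ((etaleBaseChange (f ≫ g)).obj (Scheme.Etale.mk (𝟙 Z)))) := by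
        simp only [Category.assoc]
    _ = constantSection Z.smallEtaleTopology M (Scheme.Etale.mk (𝟙 Z)) ≫ (((etaleInverseImageAdjunction g A).unit.app ((constantSheaf Z.smallEtaleTopology A).obj M)).hom.app (op (Scheme.Etale.mk (𝟙 Z))) ≫ ((etaleInverseImageAdjunction f A).unit.app ((etaleInverseImage g A).obj ((constantSheaf Z.smallEtaleTopology A).obj M))).hom.app (op ((etaleBaseChange g).obj (Scheme.Etale.mk (𝟙 Z)))) ≫ ((etaleInverseImage f A).obj ((etaleInverseImage g A).obj ((constantSheaf Z.smallEtaleTopology A).obj M))).obj.map ((etaleBaseChangeComp f g).hom.app (Scheme.Etale.mk (𝟙 Z))).op) ≫ ((etaleInverseImage f A).map (etaleInverseImageConstantSheafIso g A M).hom).hom.app (op ((etaleBaseChange (f ≫ g)).obj (Scheme.Etale.mk (𝟙 Z)))) ≫ ((etaleInverseImageConstantSheafIso f A M).hom).hom.app (op ((etaleBaseChange (f ≫ g)).obj (Scheme.Etale.mk (𝟙 Z)))) := by rw [s2]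
    _ = constantSection Z.smallEtaleTopology M (Scheme.Etale.mk (𝟙 Z)) ≫ ((etaleInverseImageAdjunction g A).unit.app ((constantSheaf Z.smallEtaleTopology A).obj M)).hom.app (op (Scheme.Etale.mk (𝟙 Z))) ≫ ((etaleInverseImageAdjunction f A).unit.app ((etaleInverseImage g A).obj ((constantSheaf Z.smallEtaleTopology A).obj M))).hom.app (op ((etaleBaseChange g).obj (Scheme.Etale.mk (𝟙 Z)))) ≫ (((etaleInverseImage f A).obj ((etaleInverseImage g A).obj ((constantSheaf Z.smallEtaleTopology A).obj M))).obj.map ((etaleBaseChangeComp f g).hom.app (Scheme.Etale.mk (𝟙 Z))).op ≫ ((etaleInverseImage f A).map (etaleInverseImageConstantSheafIso g A M).hom).hom.app (op ((etaleBaseChange (f ≫ g)).obj (Scheme.Etale.mk (𝟙 Z))))) ≫ ((etaleInverseImageConstantSheafIso f A M).hom).hom.app (op ((etaleBaseChange (f ≫ g)).obj (Scheme.Etale.mk (𝟙 Z)))) := by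
        simp only [Category.assoc]
    _ = constantSection Z.smallEtaleTopology M (Scheme.Etale.mk (𝟙 Z)) ≫ ((etaleInverseImageAdjunction g A).unit.app ((constantSheaf Z.smallEtaleTopology A).obj M)).hom.app (op (Scheme.Etale.mk (𝟙 Z))) ≫ ((etaleInverseImageAdjunction f A).unit.app ((etaleInverseImage g A).obj ((constantSheaf Z.smallEtaleTopology A).obj M))).hom.app (op ((etaleBaseChange g).obj (Scheme.Etale.mk (𝟙 Z)))) ≫ (((etaleInverseImage f A).map (etaleInverseImageConstantSheafIso g A M).hom).hom.app (op ((etaleBaseChange f).obj ((etaleBaseChange g).obj (Scheme.Etale.mk (𝟙 Z))))) ≫ ((etaleInverseImage f A).obj ((constantSheaf Y.smallEtaleTopology A).obj M)).obj.map ((etaleBaseChangeComp f g).hom.app (Scheme.Etale.mk (𝟙 Z))).op) ≫ ((etaleInverseImageConstantSheafIso f A M).hom).hom.app (op ((etaleBaseChange (f ≫ g)).obj (Scheme.Etale.mk (𝟙 Z)))) := by rw [s3]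
    _ = constantSection Z.smallEtaleTopology M (Scheme.Etale.mk (𝟙 Z)) ≫ ((etaleInverseImageAdjunction g A).unit.app ((constantSheaf Z.smallEtaleTopology A).obj M)).hom.app (op (Scheme.Etale.mk (𝟙 Z))) ≫ (((etaleInverseImageAdjunction f A).unit.app ((etaleInverseImage g A).obj ((constantSheaf Z.smallEtaleTopology A).obj M))).hom.app (op ((etaleBaseChange g).obj (Scheme.Etale.mk (𝟙 Z)))) ≫ ((etaleInverseImage f A).map (etaleInverseImageConstantSheafIso g A M).hom).hom.app (op ((etaleBaseChange f).obj ((etaleBaseChange g).obj (Scheme.Etale.mk (𝟙 Z)))))) ≫ ((etaleInverseImage f A).obj ((constantSheaf Y.smallEtaleTopology A).obj M)).obj.map ((etaleBaseChangeComp f g).hom.app (Scheme.Etale.mk (𝟙 Z))).op ≫ ((etaleInverseImageConstantSheafIso f A M).hom).hom.app (op ((etaleBaseChange (f ≫ g)).obj (Scheme.Etale.mk (𝟙 Z)))) := by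
        simp only [Category.assoc]
    _ = constantSection Z.smallEtaleTopology M (Scheme.Etale.mk (𝟙 Z)) ≫ ((etaleInverseImageAdjunction g A).unit.app ((constantSheaf Z.smallEtaleTopology A).obj M)).hom.app (op (Scheme.Etale.mk (𝟙 Z))) ≫ (((etaleInverseImageConstantSheafIso g A M).hom).hom.app (op ((etaleBaseChange g).obj (Scheme.Etale.mk (𝟙 Z)))) ≫ ((etaleInverseImageAdjunction f A).unit.app ((constantSheaf Y.smallEtaleTopology A).obj M)).hom.app (op ((etaleBaseChange g).obj (Scheme.Etale.mk (𝟙 Z))))) ≫ ((etaleInverseImage f A).obj ((constantSheaf Y.smallEtaleTopology A).obj M)).obj.map ((etaleBaseChangeComp f g).hom.app (Scheme.Etale.mk (𝟙 Z))).op ≫ ((etaleInverseImageConstantSheafIso f A M).hom).hom.app (op ((etaleBaseChange (f ≫ g)).obj (Scheme.Etale.mk (𝟙 Z)))) := by rw [s4]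
    _ = (constantSection Z.smallEtaleTopology M (Scheme.Etale.mk (𝟙 Z)) ≫ ((etaleInverseImageAdjunction g A).unit.app ((constantSheaf Z.smallEtaleTopology A).obj M)).hom.app (op (Scheme.Etale.mk (𝟙 Z))) ≫ ((etaleInverseImageConstantSheafIso g A M).hom).hom.app (op ((etaleBaseChange g).obj (Scheme.Etale.mk (𝟙 Z))))) ≫ ((etaleInverseImageAdjunction f A).unit.app ((constantSheaf Y.smallEtaleTopology A).obj M)).hom.app (op ((etaleBaseChange g).obj (Scheme.Etale.mk (𝟙 Z)))) ≫ ((etaleInverseImage f A).obj ((constantSheaf Y.smallEtaleTopology A).obj M)).obj.map ((etaleBaseChangeComp f g).hom.app (Scheme.Etale.mk (𝟙 Z))).op ≫ ((etaleInverseImageConstantSheafIso f A M).hom).hom.app (op ((etaleBaseChange (f ≫ g)).obj (Scheme.Etale.mk (𝟙 Z)))) := by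
        simp only [Category.assoc]
    _ = constantSection Y.smallEtaleTopology M ((etaleBaseChange g).obj (Scheme.Etale.mk (𝟙 Z))) ≫ ((etaleInverseImageAdjunction f A).unit.app ((constantSheaf Y.smallEtaleTopology A).obj M)).hom.app (op ((etaleBaseChange g).obj (Scheme.Etale.mk (𝟙 Z)))) ≫ ((etaleInverseImage f A).obj ((constantSheaf Y.smallEtaleTopology A).obj M)).obj.map ((etaleBaseChangeComp f g).hom.app (Scheme.Etale.mk (𝟙 Z))).op ≫ ((etaleInverseImageConstantSheafIso f A M).hom).hom.app (op ((etaleBaseChange (f ≫ g)).obj (Scheme.Etale.mk (𝟙 Z)))) := by rw [s5]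
    _ = constantSection Y.smallEtaleTopology M ((etaleBaseChange g).obj (Scheme.Etale.mk (𝟙 Z))) ≫ ((etaleInverseImageAdjunction f A).unit.app ((constantSheaf Y.smallEtaleTopology A).obj M)).hom.app (op ((etaleBaseChange g).obj (Scheme.Etale.mk (𝟙 Z)))) ≫ (((etaleInverseImageConstantSheafIso f A M).hom).hom.app (op ((etaleBaseChange f).obj ((etaleBaseChange g).obj (Scheme.Etale.mk (𝟙 Z))))) ≫ ((constantSheaf X.smallEtaleTopology A).obj M).obj.map ((etaleBaseChangeComp f g).hom.app (Scheme.Etale.mk (𝟙 Z))).op) := by rw [s6]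
    _ = (constantSection Y.smallEtaleTopology M ((etaleBaseChange g).obj (Scheme.Etale.mk (𝟙 Z))) ≫ ((etaleInverseImageAdjunction f A).unit.app ((constantSheaf Y.smallEtaleTopology A).obj M)).hom.app (op ((etaleBaseChange g).obj (Scheme.Etale.mk (𝟙 Z)))) ≫ ((etaleInverseImageConstantSheafIso f A M).hom).hom.app (op ((etaleBaseChange f).obj ((etaleBaseChange g).obj (Scheme.Etale.mk (𝟙 Z)))))) ≫ ((constantSheaf X.smallEtaleTopology A).obj M).obj.map ((etaleBaseChangeComp f g).hom.app (Scheme.Etale.mk (𝟙 Z))).op := by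
        simp only [Category.assoc]
    _ = constantSection X.smallEtaleTopology M ((etaleBaseChange f).obj ((etaleBaseChange g).obj (Scheme.Etale.mk (𝟙 Z)))) ≫ ((constantSheaf X.smallEtaleTopology A).obj M).obj.map ((etaleBaseChangeComp f g).hom.app (Scheme.Etale.mk (𝟙 Z))).op := by rw [s7]
    _ = constantSection X.smallEtaleTopology M ((etaleBaseChange (f ≫ g)).obj (Scheme.Etale.mk (𝟙 Z))) := s8

set_option backward.isDefEq.respectTransparency false in
/-- **Compatibility of `(g f)^* ≅ f^* g^*` with `π^* M ≅ M`**: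
`(gf)^* M_Z ≅ f^* g^* M_Z ≅ f^* M_Y ≅ M_X` equals `(gf)^* M_Z ≅ M_X`. [folklore] -/
theorem etaleInverseImageComp_inv_app_comp_constantSheafIso :
    (etaleInverseImageComp f A g).inv.app ((constantSheaf Z.smallEtaleTopology A).obj M) ≫
      (etaleInverseImage f A).map (etaleInverseImageConstantSheafIso g A M).hom ≫
        (etaleInverseImageConstantSheafIso f A M).hom =
      (etaleInverseImageConstantSheafIso (f ≫ g) A M).hom := by
  rw [← Iso.inv_comp_eq_id]
  apply constantSheaf_hom_ext (isTerminalEtaleBaseChangeObjMkId (f ≫ g))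
  change constantSection X.smallEtaleTopology M ((etaleBaseChange (f ≫ g)).obj (Scheme.Etale.mk (𝟙 Z))) ≫ ((etaleInverseImageConstantSheafIso (f ≫ g) A M).inv).hom.app (op ((etaleBaseChange (f ≫ g)).obj (Scheme.Etale.mk (𝟙 Z)))) ≫ ((etaleInverseImageComp f A g).inv.app ((constantSheaf Z.smallEtaleTopology A).obj M)).hom.app (op ((etaleBaseChange (f ≫ g)).obj (Scheme.Etale.mk (𝟙 Z)))) ≫
      ((etaleInverseImage f A).map (etaleInverseImageConstantSheafIso g A M).hom).hom.app (op ((etaleBaseChange (f ≫ g)).obj (Scheme.Etale.mk (𝟙 Z)))) ≫ ((etaleInverseImageConstantSheafIso f A M).hom).hom.app (op ((etaleBaseChange (f ≫ g)).obj (Scheme.Etale.mk (𝟙 Z)))) = constantSection X.smallEtaleTopology M ((etaleBaseChange (f ≫ g)).obj (Scheme.Etale.mk (𝟙 Z))) ≫ 𝟙 _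
  rw [Category.comp_id]
  exact constantSection_comp_inverseImageConstantSheafIso_coherence f A g M

end CompConstant

/-! ### Identity: `(𝟙_X)^* ≅ 𝟭` for `A`-valued sheaves -/

section Id

variable (X)

/-- **`(𝟙_X)_* = 𝟭`** (the case `π = 𝟙` of Milne II Rem. 3.1 (f)), induced by `etaleBaseChangeId`.
[folklore] -/
noncomputable def etalePushforwardIdIso : etalePushforward (𝟙 X) A ≅ 𝟭 _ :=
  Functor.sheafPushforwardContinuousId' (etaleBaseChangeId X) A X.smallEtaleTopology

omit [HasColimits A] [HasLimits A] [Abelian A] [IsGrothendieckAbelian.{u} A] in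
/-- Components of `etalePushforwardIdIso`: `P(U) → ((𝟙_X)_* P)(U) = P(U ×_X X)` is restriction along
`U ×_X X ≅ U`. [folklore] -/
theorem etalePushforwardIdIso_inv_app_hom_app (P : Sheaf X.smallEtaleTopology A) (U : X.Etale) :
    ((etalePushforwardIdIso X A).inv.app P).hom.app (op U) =
      P.obj.map ((etaleBaseChangeId X).hom.app U).op := by
  simp [etalePushforwardIdIso, Functor.sheafPushforwardContinuousId',
    Functor.sheafPushforwardContinuousId, Functor.sheafPushforwardContinuousIso]
  exact Category.id_comp _

/-- **`(𝟙_X)^* ≅ 𝟭`**: the isomorphism of left adjoints conjugate to `etalePushforwardIdIso`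
(Mathlib `Adjunction.leftAdjointIdIso`). [folklore] -/
noncomputable def etaleInverseImageId : etaleInverseImage (𝟙 X) A ≅ 𝟭 _ :=
  (etaleInverseImageAdjunction (𝟙 X) A).leftAdjointIdIso (etalePushforwardIdIso X A)

/-- `etaleInverseImageId` is conjugate to `etalePushforwardIdIso`. [folklore] -/
theorem conjugateEquiv_etaleInverseImageId_hom :
    conjugateEquiv .id (etaleInverseImageAdjunction (𝟙 X) A) (etaleInverseImageId X A).hom =
      (etalePushforwardIdIso X A).inv :=
  Adjunction.conjugateEquiv_leftAdjointIdIso_hom _ _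

set_option backward.isDefEq.respectTransparency false in
/-- The unit relation defining `etaleInverseImageId`: `η_𝟙(U) ≫ u_P(U ×_X X) = (restriction along
U ×_X X ≅ U)`. [folklore] -/
theorem unit_app_comp_etaleInverseImageId_hom_app (P : Sheaf X.smallEtaleTopology A)
    (U : X.Etale) :
    ((etaleInverseImageAdjunction (𝟙 X) A).unit.app P).hom.app (op (U)) ≫ ((etaleInverseImageId X A).hom.app P).hom.app (op ((etaleBaseChange (𝟙 X)).obj U)) =
      P.obj.map ((etaleBaseChangeId X).hom.app U).op := by
  have h := unit_conjugateEquiv Adjunction.id (etaleInverseImageAdjunction (𝟙 X) A)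
    (etaleInverseImageId X A).hom P
  rw [conjugateEquiv_etaleInverseImageId_hom] at h
  have h' := Sheaf.congr_hom_app h (op U)
  have e1 : (((Adjunction.id (C := Sheaf X.smallEtaleTopology A)).unit.app P) ≫
      (etalePushforwardIdIso X A).inv.app P).hom.app (op U) =
      P.obj.map ((etaleBaseChangeId X).hom.app U).op := by
    rw [← etalePushforwardIdIso_inv_app_hom_app]
    exact Category.id_comp _
  exact h'.symm.trans e1

variable (M : A)

set_option backward.isDefEq.respectTransparency false in
/-- **Compatibility of `(𝟙_X)^* ≅ 𝟭` with `π^* M ≅ M`**: on `M_X` the two isomorphisms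
`(𝟙_X)^* M_X ≅ M_X` agree. [folklore] -/
theorem etaleInverseImageId_hom_app_constantSheaf :
    (etaleInverseImageId X A).hom.app ((constantSheaf X.smallEtaleTopology A).obj M) = (etaleInverseImageConstantSheafIso (𝟙 X) A M).hom := by
  rw [← Iso.inv_comp_eq_id]
  apply constantSheaf_hom_ext (isTerminalEtaleBaseChangeObjMkId (𝟙 X))
  change constantSection X.smallEtaleTopology M ((etaleBaseChange (𝟙 X)).obj (Scheme.Etale.mk (𝟙 X))) ≫ ((etaleInverseImageConstantSheafIso (𝟙 X) A M).inv).hom.app (op ((etaleBaseChange (𝟙 X)).obj (Scheme.Etale.mk (𝟙 X)))) ≫ ((etaleInverseImageId X A).hom.app ((constantSheaf X.smallEtaleTopology A).obj M)).hom.app (op ((etaleBaseChange (𝟙 X)).obj (Scheme.Etale.mk (𝟙 X)))) = constantSection X.smallEtaleTopology M ((etaleBaseChange (𝟙 X)).obj (Scheme.Etale.mk (𝟙 X))) ≫ 𝟙 _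
  rw [Category.comp_id]
  have L1 := constantSection_comp_unit_comp_inverseImageConstantSheafIso (𝟙 X) A M (Scheme.Etale.mk (𝟙 X))
  have hinv : ((etaleInverseImageConstantSheafIso (𝟙 X) A M).hom).hom.app (op ((etaleBaseChange (𝟙 X)).obj (Scheme.Etale.mk (𝟙 X)))) ≫ ((etaleInverseImageConstantSheafIso (𝟙 X) A M).inv).hom.app (op ((etaleBaseChange (𝟙 X)).obj (Scheme.Etale.mk (𝟙 X)))) = 𝟙 _ :=
    Sheaf.congr_hom_app (etaleInverseImageConstantSheafIso (𝟙 X) A M).hom_inv_id (op ((etaleBaseChange (𝟙 X)).obj (Scheme.Etale.mk (𝟙 X))))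
  have hinv' : ((etaleInverseImageAdjunction (𝟙 X) A).unit.app ((constantSheaf X.smallEtaleTopology A).obj M)).hom.app (op (Scheme.Etale.mk (𝟙 X))) ≫ ((etaleInverseImageConstantSheafIso (𝟙 X) A M).hom).hom.app (op ((etaleBaseChange (𝟙 X)).obj (Scheme.Etale.mk (𝟙 X)))) ≫ ((etaleInverseImageConstantSheafIso (𝟙 X) A M).inv).hom.app (op ((etaleBaseChange (𝟙 X)).obj (Scheme.Etale.mk (𝟙 X)))) = ((etaleInverseImageAdjunction (𝟙 X) A).unit.app ((constantSheaf X.smallEtaleTopology A).obj M)).hom.app (op (Scheme.Etale.mk (𝟙 X))) := by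
    rw [hinv]; exact Category.comp_id _
  have s1 : constantSection X.smallEtaleTopology M ((etaleBaseChange (𝟙 X)).obj (Scheme.Etale.mk (𝟙 X))) ≫ ((etaleInverseImageConstantSheafIso (𝟙 X) A M).inv).hom.app (op ((etaleBaseChange (𝟙 X)).obj (Scheme.Etale.mk (𝟙 X)))) = constantSection X.smallEtaleTopology M (Scheme.Etale.mk (𝟙 X)) ≫ ((etaleInverseImageAdjunction (𝟙 X) A).unit.app ((constantSheaf X.smallEtaleTopology A).obj M)).hom.app (op (Scheme.Etale.mk (𝟙 X))) := by
    rw [← L1]; simp only [Category.assoc]; rw [hinv']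
  have s2 : ((etaleInverseImageAdjunction (𝟙 X) A).unit.app ((constantSheaf X.smallEtaleTopology A).obj M)).hom.app (op (Scheme.Etale.mk (𝟙 X))) ≫ ((etaleInverseImageId X A).hom.app ((constantSheaf X.smallEtaleTopology A).obj M)).hom.app (op ((etaleBaseChange (𝟙 X)).obj (Scheme.Etale.mk (𝟙 X)))) = ((constantSheaf X.smallEtaleTopology A).obj M).obj.map ((etaleBaseChangeId X).hom.app (Scheme.Etale.mk (𝟙 X))).op :=
    unit_app_comp_etaleInverseImageId_hom_app X A ((constantSheaf X.smallEtaleTopology A).obj M) (Scheme.Etale.mk (𝟙 X))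
  have s3 : constantSection X.smallEtaleTopology M (Scheme.Etale.mk (𝟙 X)) ≫ ((constantSheaf X.smallEtaleTopology A).obj M).obj.map ((etaleBaseChangeId X).hom.app (Scheme.Etale.mk (𝟙 X))).op = constantSection X.smallEtaleTopology M ((etaleBaseChange (𝟙 X)).obj (Scheme.Etale.mk (𝟙 X))) :=
    constantSection_comp_map X.smallEtaleTopology M ((etaleBaseChangeId X).hom.app (Scheme.Etale.mk (𝟙 X)))
  calc constantSection X.smallEtaleTopology M ((etaleBaseChange (𝟙 X)).obj (Scheme.Etale.mk (𝟙 X))) ≫ ((etaleInverseImageConstantSheafIso (𝟙 X) A M).inv).hom.app (op ((etaleBaseChange (𝟙 X)).obj (Scheme.Etale.mk (𝟙 X)))) ≫ ((etaleInverseImageId X A).hom.app ((constantSheaf X.smallEtaleTopology A).obj M)).hom.app (op ((etaleBaseChange (𝟙 X)).obj (Scheme.Etale.mk (𝟙 X))))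
      = (constantSection X.smallEtaleTopology M ((etaleBaseChange (𝟙 X)).obj (Scheme.Etale.mk (𝟙 X))) ≫ ((etaleInverseImageConstantSheafIso (𝟙 X) A M).inv).hom.app (op ((etaleBaseChange (𝟙 X)).obj (Scheme.Etale.mk (𝟙 X))))) ≫ ((etaleInverseImageId X A).hom.app ((constantSheaf X.smallEtaleTopology A).obj M)).hom.app (op ((etaleBaseChange (𝟙 X)).obj (Scheme.Etale.mk (𝟙 X)))) := by simp only [Category.assoc]
    _ = (constantSection X.smallEtaleTopology M (Scheme.Etale.mk (𝟙 X)) ≫ ((etaleInverseImageAdjunction (𝟙 X) A).unit.app ((constantSheaf X.smallEtaleTopology A).obj M)).hom.app (op (Scheme.Etale.mk (𝟙 X)))) ≫ ((etaleInverseImageId X A).hom.app ((constantSheaf X.smallEtaleTopology A).obj M)).hom.app (op ((etaleBaseChange (𝟙 X)).obj (Scheme.Etale.mk (𝟙 X)))) := by rw [s1]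
    _ = constantSection X.smallEtaleTopology M (Scheme.Etale.mk (𝟙 X)) ≫ (((etaleInverseImageAdjunction (𝟙 X) A).unit.app ((constantSheaf X.smallEtaleTopology A).obj M)).hom.app (op (Scheme.Etale.mk (𝟙 X))) ≫ ((etaleInverseImageId X A).hom.app ((constantSheaf X.smallEtaleTopology A).obj M)).hom.app (op ((etaleBaseChange (𝟙 X)).obj (Scheme.Etale.mk (𝟙 X))))) := by simp only [Category.assoc]
    _ = constantSection X.smallEtaleTopology M (Scheme.Etale.mk (𝟙 X)) ≫ ((constantSheaf X.smallEtaleTopology A).obj M).obj.map ((etaleBaseChangeId X).hom.app (Scheme.Etale.mk (𝟙 X))).op := by rw [s2]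
    _ = constantSection X.smallEtaleTopology M ((etaleBaseChange (𝟙 X)).obj (Scheme.Etale.mk (𝟙 X))) := s3

end Id

end Literature.AlgebraicGeometry.Motives
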